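import Mathlib.CategoryTheory.NatIso
import Mathlib.CategoryTheory.Equivalence
import Mathlib.CategoryTheory.Whiskering
import Literature.AlgebraicGeometry.Frobenioids.NaiveFrobeniusDescent
import Literature.AlgebraicGeometry.Frobenioids.NaiveFrobeniusFunctorLifts
import HarnessLib

/-!
# Frobenioids I, Proposition 2.1 (iii) and Remark 2.1.1 — proofs (node ids FrdI:Prop2.1(iii), FrdI:Rmk2.1.1)

Mochizuki, *The geometry of Frobenioids I: the general theory*, Kyushu J. Math. **62** (2008),
§2, Proposition 2.1 (iii) and Remark 2.1.1, kurims text pp. 44–45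
[cite: MochizukiFrdI2008, Prop. 2.1(iii) p.44].  PROOF-ONLY companion of
`NaiveFrobeniusFunctor.lean` (seat abc-iut-L1-t2): it discharges the three named statements
`NaiveFrobeniusEquivalenceOfPerfect`, `NaiveFrobeniusPerfectIff`, `NaiveFrobeniusRatIndependent`
as the theorems `…_holds` below; no new definition, no statement is changed.

Printed proof (p. 44–45) and how it is followed.  *Sufficiency* ("`Ψ` an equivalence ⇒ perfect
type") "follows immediately from the definition of perfect": essential surjectivity of `Ψ_n` gives
the morphisms of Frobenius type of degree `n` INTO every object; full faithfulness gives the unique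
descent of pre-steps (`isOfPerfectType_of_isEquivalence`; the lifting property of Prop. 1.10 (i)
is supplied by `hasFrobeniusLifts`, `NaiveFrobeniusFunctorLifts.lean`).  *Necessity*: essential
surjectivity from the first clause of "perfect" (`naiveFrobenius_essSurj`); fullness and
faithfulness from the descent lemmas of `NaiveFrobeniusDescent.lean` (`exists_descent`,
`cancel_frobeniusType`).  Remark 2.1.1 (`Ψ_b⁻¹ ∘ Ψ_a` depends only on `a/b`) is functor algebra
over Prop. 2.1 (i) (composites and well-definedness up to isomorphism, PROVED in
`NaiveFrobeniusFunctor.lean`).  Composition is diagrammatic.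
-/

namespace Literature.AlgebraicGeometry.Frobenioids

open CategoryTheory Opposite

universe w v v' u u'

namespace PreFrobenioid

variable {D : Type u} [Category.{v} D] {Φ : Dᵒᵖ ⥤ CommMonCat.{w}}
  {C : Type u'} [Category.{v'} C] {F : C ⥤ ElemFrobenioid Φ} {d : ℕ+}

/-! ### Proposition 2.1 (iii), necessity: perfect type ⇒ `Ψ` is an equivalence -/

/-- **Prop. 2.1 (iii)**, necessity, essential surjectivity: "the essential surjectivity of `Ψ`
follows immediately from the definition of perfect" (p. 44) — every `B` is the codomain of a
morphism of Frobenius type of degree `d`, which is isomorphic under its domain to the chosen one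
(Def. 1.3 (ii)). [cite: MochizukiFrdI2008, Prop. 2.1(iii) p.44] -/
theorem naiveFrobenius_essSurj (hF : IsFrobenioid F) (hP : IsOfPerfectType F)
    (ch : FrobeniusChoice F d) (h : HasFrobeniusLifts F d) : (naiveFrobenius ch h).EssSurj where
  mem_essImage B := by
    obtain ⟨B₀, φ, hφ, hφd⟩ := (hP B d).1 B ⟨Iso.refl _⟩
    obtain ⟨e, -⟩ := hF.ii_unique (ch.hom B₀) φ (ch.isFrobeniusType B₀) hφ
      ((ch.degFr_eq B₀).trans hφd.symm)
    exact ⟨B₀, ⟨e⟩⟩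

/-- **Prop. 2.1 (iii)**, necessity, fullness of `Ψ` (from `exists_descent` and the uniqueness of
lifts, Prop. 1.10 (i)). [cite: MochizukiFrdI2008, Prop. 2.1(iii) p.44] -/
theorem naiveFrobenius_full (hF : IsFrobenioid F) (hP : IsOfPerfectType F)
    (ch : FrobeniusChoice F d) (h : HasFrobeniusLifts F d) : (naiveFrobenius ch h).Full where
  map_surjective := by
    intro A B ψ'
    obtain ⟨ψ, hψ⟩ := exists_descent hF hP (ch.isFrobeniusType A) (ch.isFrobeniusType B)
      ((ch.degFr_eq A).trans (ch.degFr_eq B).symm) ψ'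
    exact ⟨ψ, (ch.lift_unique h ψ ψ' hψ.symm).symm⟩

/-- **Prop. 2.1 (iii)**, necessity, faithfulness of `Ψ` (from `cancel_frobeniusType`).
[cite: MochizukiFrdI2008, Prop. 2.1(iii) p.44] -/
theorem naiveFrobenius_faithful (hF : IsFrobenioid F) (hP : IsOfPerfectType F)
    (ch : FrobeniusChoice F d) (h : HasFrobeniusLifts F d) : (naiveFrobenius ch h).Faithful where
  map_injective := by
    intro A B ψ₁ ψ₂ e
    apply cancel_frobeniusType hF hP (ch.isFrobeniusType B)
    change ch.lift h ψ₁ = ch.lift h ψ₂ at e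
    rw [← ch.hom_lift h ψ₁, e, ch.hom_lift h ψ₂]

/-- **Prop. 2.1 (iii)**, necessity: "suppose that `C` is of perfect type. Then … `Ψ` is … [an
equivalence]" — essentially surjective, full and faithful.
[cite: MochizukiFrdI2008, Prop. 2.1(iii) p.44] -/
theorem naiveFrobenius_isEquivalence (hF : IsFrobenioid F) (hP : IsOfPerfectType F)
    (ch : FrobeniusChoice F d) (h : HasFrobeniusLifts F d) : (naiveFrobenius ch h).IsEquivalence :=
  Functor.IsEquivalence.mk (naiveFrobenius_faithful hF hP ch h) (naiveFrobenius_full hF hP ch h)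
    (naiveFrobenius_essSurj hF hP ch h)

/-- **Prop. 2.1 (iii)**, necessity, degree by degree — the named statement
`NaiveFrobeniusEquivalenceOfPerfect F d` of `NaiveFrobeniusFunctor.lean` HOLDS.
[cite: MochizukiFrdI2008, Prop. 2.1(iii) p.44] -/
theorem naiveFrobeniusEquivalenceOfPerfect_holds (d : ℕ+) : NaiveFrobeniusEquivalenceOfPerfect F d :=
  fun hF hP ch h => naiveFrobenius_isEquivalence hF hP ch h

/-! ### Proposition 2.1 (iii), sufficiency: `Ψ_n` an equivalence for every `n` ⇒ perfect type -/

/-- **Prop. 2.1 (iii)**, sufficiency: "follows immediately from the definition of perfect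
[cf. Definition 1.2, (iv); Remark 1.1.1]" (p. 44) — if every naive Frobenius functor `Ψ_n` is an
equivalence then `C` is of perfect type: essential surjectivity of `Ψ_n` yields the morphisms of
Frobenius type of degree `n` into any `B`; full faithfulness yields the unique descent of a
pre-step `ψ'` along `φ₁`, `φ₂` (which are the chosen `α`'s up to isomorphism, Def. 1.3 (ii)); the
descended arrow is a pre-step by Remark 1.1.1 and Prop. 1.7 (v).  The lifting property of
Prop. 1.10 (i) enters as the hypothesis `hlift`. [cite: MochizukiFrdI2008, Prop. 2.1(iii) p.44] -/
theorem isOfPerfectType_of_isEquivalence (hF : IsFrobenioid F)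
    (hlift : ∀ n : ℕ+, HasFrobeniusLifts F n)
    (hE : ∀ (n : ℕ+) (ch : FrobeniusChoice F n) (h : HasFrobeniusLifts F n),
      (naiveFrobenius ch h).IsEquivalence) :
    IsOfPerfectType F := by
  have hP' := hF.isPreFrobenioid
  intro A n
  obtain ⟨ch⟩ := nonempty_frobeniusChoice F hF n
  have h := hlift n
  haveI := hE n ch h
  refine ⟨fun B _ => ?_, ?_⟩
  · obtain ⟨B₀, ⟨e⟩⟩ := Functor.EssSurj.mem_essImage (naiveFrobenius ch h) B
    change ch.obj B₀ ≅ B at e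
    refine ⟨B₀, ch.hom B₀ ≫ e.hom,
      IsFrobeniusType.comp F hF (ch.isFrobeniusType B₀) (isFrobeniusType_of_isIso F hP' e.hom), ?_⟩
    rw [degFr_comp, ch.degFr_eq, show degFr F e.hom = 1 from isLinear_of_isIso F e.hom, mul_one]
  · intro B₁ B₁' B₂ B₂' φ₁ φ₂ _ _ hφ₁ hd₁ hφ₂ hd₂ ψ' hψ'
    obtain ⟨e₁, he₁⟩ := hF.ii_unique (ch.hom B₁) φ₁ (ch.isFrobeniusType B₁) hφ₁
      ((ch.degFr_eq B₁).trans hd₁.symm)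
    obtain ⟨e₂, he₂⟩ := hF.ii_unique (ch.hom B₂) φ₂ (ch.isFrobeniusType B₂) hφ₂
      ((ch.degFr_eq B₂).trans hd₂.symm)
    -- `ψ ↦ ψ'` is `Ψ` up to the isomorphisms `e₁`, `e₂`
    have key : ∀ ψ : B₁ ⟶ B₂,
        ψ ≫ φ₂ = φ₁ ≫ ψ' ↔ (naiveFrobenius ch h).map ψ = e₁.hom ≫ ψ' ≫ e₂.inv := by
      intro ψ
      constructor
      · intro hsq
        symm
        apply ch.lift_unique h
        calc ch.hom B₁ ≫ e₁.hom ≫ ψ' ≫ e₂.inv = ((ch.hom B₁ ≫ e₁.hom) ≫ ψ') ≫ e₂.inv := by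
              simp only [Category.assoc]
          _ = (ψ ≫ ch.hom B₂ ≫ e₂.hom) ≫ e₂.inv := by rw [he₁, ← hsq, ← he₂]
          _ = ψ ≫ ch.hom B₂ := by simp only [Category.assoc, Iso.hom_inv_id, Category.comp_id]
      · intro hl
        have hsq := ch.hom_lift h ψ
        rw [show ch.lift h ψ = e₁.hom ≫ ψ' ≫ e₂.inv from hl] at hsq
        calc ψ ≫ φ₂ = (ψ ≫ ch.hom B₂) ≫ e₂.hom := by rw [← he₂, Category.assoc]
          _ = (ch.hom B₁ ≫ e₁.hom ≫ ψ' ≫ e₂.inv) ≫ e₂.hom := by rw [hsq]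
          _ = φ₁ ≫ ψ' := by
              rw [← he₁]; simp only [Category.assoc, Iso.inv_hom_id, Category.comp_id]
    obtain ⟨ψ, hψ⟩ := (naiveFrobenius ch h).map_surjective (e₁.hom ≫ ψ' ≫ e₂.inv)
    have hsq : ψ ≫ φ₂ = φ₁ ≫ ψ' := (key ψ).2 hψ
    refine ⟨ψ, ⟨⟨?_, ?_⟩, hsq⟩, ?_⟩
    · -- linear (Remark 1.1.1)
      have e := congrArg (degFr F) hsq
      rw [degFr_comp, degFr_comp, hd₁, hd₂, show degFr F ψ' = 1 from hψ'.1, mul_one] at e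
      show degFr F ψ = 1
      exact mul_right_cancel (e.trans (one_mul n).symm)
    · -- base-isomorphism (Prop. 1.7 (v))
      have hb : IsBaseIso F (ψ ≫ φ₂) := by rw [hsq]; exact IsBaseIso.comp F hφ₁.2 hψ'.2
      exact (isBaseIso_factors F hP'.isTotallyEpimorphic_base hb).2
    · rintro ψ₀ ⟨-, hψ₀⟩
      exact (naiveFrobenius ch h).map_injective (((key ψ₀).1 hψ₀).trans hψ.symm)

/-- **Prop. 2.1 (iii)** — the named statement `NaiveFrobeniusPerfectIff F` of
`NaiveFrobeniusFunctor.lean` HOLDS: "`C` is of perfect type if and only if `Ψ` is an equivalence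
of categories" (with `Ψ` ranging over the naive Frobenius functors of all degrees, as typed; the
lifting hypothesis is discharged by Prop. 1.10 (i), `hasFrobeniusLifts`).
[cite: MochizukiFrdI2008, Prop. 2.1(iii) p.44] -/
theorem naiveFrobeniusPerfectIff_holds : NaiveFrobeniusPerfectIff F := fun hF =>
  ⟨fun hP _ ch h => naiveFrobenius_isEquivalence hF hP ch h,
    fun hE => isOfPerfectType_of_isEquivalence hF (hasFrobeniusLifts hF) hE⟩

/-- `NaiveFrobeniusPerfectIff` — `_holds` alias of `naiveFrobeniusPerfectIff_holds` above under the fact's exact name (appended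
2026-08-28, D-0026 bookkeeping: the proof term is the existing theorem of this file; no statement,
definition or attribute is edited; no new named fact; the ledger's debt table listed the fact
unproved). [cite: MochizukiFrdI2008, Prop. 2.1(iii) p.44] -/
theorem _root_.Literature.AlgebraicGeometry.Frobenioids.PreFrobenioid.NaiveFrobeniusPerfectIff_holds :
    NaiveFrobeniusPerfectIff F :=
  _root_.Literature.AlgebraicGeometry.Frobenioids.PreFrobenioid.naiveFrobeniusPerfectIff_holds (F := F)

/-! ### Remark 2.1.1: independence of `a`, `b` -/

/-- Naive Frobenius functors of (propositionally) equal degrees are isomorphic (Prop. 2.1 (i),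
well-definedness up to isomorphism). [cite: MochizukiFrdI2008, Prop. 2.1(i) p.44] -/
theorem nonempty_naiveFrobeniusIso_of_eq (hF : IsFrobenioid F) {d₁ d₂ : ℕ+} (e : d₁ = d₂)
    (ch₁ : FrobeniusChoice F d₁) (ch₂ : FrobeniusChoice F d₂) (h₁ : HasFrobeniusLifts F d₁)
    (h₂ : HasFrobeniusLifts F d₂) : Nonempty (naiveFrobenius ch₁ h₁ ≅ naiveFrobenius ch₂ h₂) := by
  subst e
  exact ⟨naiveFrobeniusIso hF ch₁ ch₂ h₁⟩

/-- Naive Frobenius functors commute up to isomorphism: `Ψ_b ∘ Ψ_a ≅ Ψ_{ab} = Ψ_{ba} ≅ Ψ_a ∘ Ψ_b`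
(Prop. 2.1 (i), composites). [cite: MochizukiFrdI2008, Prop. 2.1(i) p.44] -/
theorem nonempty_naiveFrobenius_comm (hF : IsFrobenioid F) {a b : ℕ+} (cha : FrobeniusChoice F a)
    (chb : FrobeniusChoice F b) (ha : HasFrobeniusLifts F a) (hb : HasFrobeniusLifts F b) :
    Nonempty (naiveFrobenius cha ha ⋙ naiveFrobenius chb hb ≅
      naiveFrobenius chb hb ⋙ naiveFrobenius cha ha) :=
  ⟨naiveFrobeniusCompIso hF cha chb ha hb (hasFrobeniusLifts hF (a * b)) ≪≫
    (nonempty_naiveFrobeniusIso_of_eq hF (mul_comm a b) (cha.comp hF chb) (chb.comp hF cha)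
      (hasFrobeniusLifts hF (a * b)) (hasFrobeniusLifts hF (b * a))).some ≪≫
    (naiveFrobeniusCompIso hF chb cha hb ha (hasFrobeniusLifts hF (b * a))).symm⟩

/-- Functor algebra: from `H' ∘ X ≅ Y ∘ H` with `H`, `H'` equivalences one gets
`X ∘ H⁻¹ ≅ H'⁻¹ ∘ Y` (quasi-inverses `Functor.inv`); private helper for Rmk. 2.1.1. [folklore] -/
private theorem nonempty_conj_iso {X Y H H' : C ⥤ C} [H.IsEquivalence] [H'.IsEquivalence]
    (J : X ⋙ H' ≅ H ⋙ Y) : Nonempty (H.inv ⋙ X ≅ Y ⋙ H'.inv) := by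
  refine ⟨Functor.isoWhiskerLeft H.inv ?_ ≪≫ H.asEquivalence.invFunIdAssoc (Y ⋙ H'.inv)⟩
  exact X.rightUnitor.symm ≪≫ Functor.isoWhiskerLeft X H'.asEquivalence.unitIso ≪≫
    (Functor.associator X H' H'.inv).symm ≪≫ Functor.isoWhiskerRight J H'.inv ≪≫
    Functor.associator H Y H'.inv

/-- **Remark 2.1.1** — the named statement `NaiveFrobeniusRatIndependent F` of
`NaiveFrobeniusFunctor.lean` HOLDS: for `d = a/b = a'/b'` the functors `Ψ_b⁻¹ ∘ Ψ_a` and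
`Ψ_{b'}⁻¹ ∘ Ψ_{a'}` are isomorphic ("by Proposition 2.1, (i), is independent of the choice of
`a`, `b`": `Ψ_{b'} ∘ Ψ_a ≅ Ψ_{ab'} = Ψ_{a'b} ≅ Ψ_b ∘ Ψ_{a'}`, then conjugate by the quasi-inverses).
[cite: MochizukiFrdI2008, Rem. 2.1.1 p.45] -/
theorem naiveFrobeniusRatIndependent_holds : NaiveFrobeniusRatIndependent F := by
  intro hF a b a' b' cha chb cha' chb' ha hb ha' hb' _ _ hab
  -- `Ψ_{b'} ∘ Ψ_a ≅ Ψ_b ∘ Ψ_{a'} ≅ Ψ_{a'} ∘ Ψ_b`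
  obtain ⟨I⟩ := nonempty_naiveFrobenius_comm hF chb cha' hb ha'
  have J : naiveFrobenius cha ha ⋙ naiveFrobenius chb' hb' ≅
      naiveFrobenius chb hb ⋙ naiveFrobenius cha' ha' :=
    naiveFrobeniusCompIso hF cha chb' ha hb' (hasFrobeniusLifts hF (a * b')) ≪≫
      (nonempty_naiveFrobeniusIso_of_eq hF hab (cha.comp hF chb') (cha'.comp hF chb)
        (hasFrobeniusLifts hF (a * b')) (hasFrobeniusLifts hF (a' * b))).some ≪≫
      (naiveFrobeniusCompIso hF cha' chb ha' hb (hasFrobeniusLifts hF (a' * b))).symm ≪≫ I.symm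
  -- `Ψ_{b'} ∘ Ψ_{a'} ≅ Ψ_{a'} ∘ Ψ_{b'}`… precisely `Ψ_{a'} ⋙ Ψ_{b'} ≅ Ψ_{b'} ⋙ Ψ_{a'}`
  obtain ⟨I'⟩ := nonempty_naiveFrobenius_comm hF cha' chb' ha' hb'
  obtain ⟨K₁⟩ := nonempty_conj_iso J
  obtain ⟨K₂⟩ := nonempty_conj_iso I'
  exact ⟨K₁ ≪≫ K₂.symm⟩

end PreFrobenioid

end Literature.AlgebraicGeometry.Frobenioids
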